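import Literature.NumberTheory.Automorphic.ArchKirillovStringBesselGL2Complex
import Literature.NumberTheory.Automorphic.ArchKTypeDescentGL2Complex
import HarnessLib

/-!
# The Kirillov function of the descent vector at a complex place of `GL₂(K_∞)` (Jacquet–Langlands (1970), §6)

Topic `NumberTheory/Automorphic`; namespace `Literature.NumberTheory.Automorphic`. Theorems only (no
definition, no named fact, no instance). For a highest-weight Gårding vector `x` of torus weight `m`
at a complex place (`E x = 0`, `τ(T) x = im x`, centre `μ₁, μ₂`, Casimirs `λ_a = (μ₁+iμ₂)²/2 - 2ν² - 2`,
`λ_h`), the descent vector `x' = P⁻ x - (4m)⁻¹ P⁰ F x - (4m(m-1))⁻¹ P⁺ F² x` of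
`ArchKTypeDescentGL2Complex.descent_highest` has the Kirillov function

  `ℓ(τ(exp yH) x') = c · θ^a (λ_h - Λ₊)(λ_h - Λ₋) / (8 a² m (m-1)) · (e^y)^{(μ₁+m-1)/2} besselMode a ν (e^y)`,
  `Λ_± = (μ₁ - iμ₂)²/2 - 2(ν ∓ im)² - 2`,

where `ℓ(τ(exp yH) x) = c (e^y)^{(μ₁+m+1)/2} besselMode a ν (e^y)` (`apply_gardingAct_descent_eq`). Hence if
`x' = 0` while the Kirillov function of `x` along `exp(ℝH)` is not identically zero, the string of `x` is
of minimal type: `λ_h = Λ₊` or `λ_h = Λ₋` (`minimalType_of_descent_eq_zero`). The computation is two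
steps of the recursion `kirillovODE_complex_string_down` and the conversions
`ℓ(τ(exp yH) P⁻ x) = g₁ + 2θ^a e^y g₀`, `ℓ(τ(exp yH) P⁰ v) = 8 g_v' - 4μ₁ g_v`,
`ℓ(τ(exp yH) P⁺ F² x) = 2θ^h e^y g₂ - 8(m-1) g₁`; the final polynomial identity (`descent_algebra`) was
found and certified with computer algebra (kit jobs j022249, j022411).

## References

* H. Jacquet, R. P. Langlands, *Automorphic Forms on GL(2)*, LNM 114 (1970), §6. [JacquetLanglands1970]
* A. W. Knapp, *Representation Theory of Semisimple Groups* (1986), Ch. VIII §3. [Knapp1986]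
-/

noncomputable section

open MeasureTheory Measure NumberField NumberField.InfinitePlace NumberField.mixedEmbedding IsDedekindDomain Set Filter
open scoped MatrixGroups Topology Classical
open Literature.Analysis.Complex

namespace Literature.NumberTheory.Automorphic

variable {K : Type} [Field K] [NumberField K]

-- as in `ArchGardingWhittaker`
set_option backward.isDefEq.respectTransparency false

/-! ### 1. The polynomial identity -/

/-- **The polynomial identity behind the descent criterion** (certified by computer algebra). The variables
stand for: `Y = e^y`, `P = Y^{κ-1}` (`κ = (μ₁+m+1)/2`), `bm, bm₁ = besselMode(₁) a ν Y`, `θh = θ₁ - iθ₂`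
(with `θh θa = -a²` already eliminated), `gt1 = 2θh g₁`, `gt1d = 2θh g₁'`, `gt1dd = 2θh g₁''`,
`M2 = (2θh)² e^y g₂` (all at `y`), in terms of the monomials `Y^{κ-1} bm, Y^κ bm₁, Y^{κ+1} bm, Y^{κ+2} bm₁`.
[folklore] -/
theorem descent_algebra {μ₁ μ₂ ν θh a m lam Y P bm bm₁ κ nq At Bt gt1 gt1d gt1dd E2gt1 M2 Lp Lm : ℂ}
    (hκ : κ = (μ₁ + m + 1) / 2) (hnq : nq = ν ^ 2 + 1 / 4)
    (hAt : At = -(2 * κ ^ 2 - 2 * nq - (2 * μ₁ - 2 * m + 4) * κ +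
      (μ₁ ^ 2 - Complex.I * μ₁ * μ₂ - μ₂ ^ 2 / 2 + 2 * μ₁ + m ^ 2 / 2 - μ₁ * m - 2 * m - lam)))
    (hBt : Bt = -(4 * κ + 2 - (2 * μ₁ - 2 * m + 4)))
    (hgt1 : gt1 = At * (P * bm) + Bt * (P * Y * bm₁))
    (hgt1d : gt1d = At * ((κ - 1) * (P * bm) + P * Y * bm₁) + Bt * (κ * (P * Y * bm₁) + a ^ 2 * (P * Y ^ 2 * bm) - nq * (P * bm)))
    (hgt1dd : gt1dd = At * ((κ - 1) * ((κ - 1) * (P * bm) + P * Y * bm₁) + (κ * (P * Y * bm₁) + a ^ 2 * (P * Y ^ 2 * bm) - nq * (P * bm))) +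
      Bt * (κ * (κ * (P * Y * bm₁) + a ^ 2 * (P * Y ^ 2 * bm) - nq * (P * bm)) + a ^ 2 * ((κ + 1) * (P * Y ^ 2 * bm) + P * Y ^ 3 * bm₁) -
        nq * ((κ - 1) * (P * bm) + P * Y * bm₁)))
    (hE2 : E2gt1 = At * (P * Y ^ 2 * bm) + Bt * (P * Y ^ 3 * bm₁))
    (hM2 : M2 = -(2 * gt1dd - (2 * μ₁ - 2 * (m - 2) + 4) * gt1d +
      (μ₁ ^ 2 - Complex.I * μ₁ * μ₂ - μ₂ ^ 2 / 2 + 2 * μ₁ + (m - 2) ^ 2 / 2 - μ₁ * (m - 2) - 2 * (m - 2) - lam) * gt1 +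
        2 * (-a ^ 2) * E2gt1))
    (hLp : Lp = (μ₁ - Complex.I * μ₂) ^ 2 / 2 - 2 * (ν - Complex.I * m) ^ 2 - 2)
    (hLm : Lm = (μ₁ - Complex.I * μ₂) ^ 2 / 2 - 2 * (ν + Complex.I * m) ^ 2 - 2) :
    4 * m * (m - 1) * (2 * θh * gt1 + 2 * (-4 * a ^ 2 * θh) * (P * Y ^ 2 * bm)) - (m - 1) * (8 * (2 * θh * gt1d) - 4 * μ₁ * (2 * θh * gt1)) -
        (2 * θh * M2 - 8 * (m - 1) * (2 * θh * gt1)) =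
      -2 * θh * (lam - Lp) * (lam - Lm) * (P * bm) := by
  subst hκ hnq
  subst hAt hBt
  subst hgt1 hgt1d hgt1dd hE2
  subst hM2 hLp hLm
  linear_combination ((((-8 : ℂ) * P * bm * θh * (m ^ 4)) + ((-4 : ℂ) * P * bm * θh * (μ₂ ^ 2)) + (16 * P * bm * θh * (m ^ 2)) + (((-1 : ℂ) / 2) * P * bm * θh * (μ₂ ^ 4)) + (P * bm * θh * (μ₁ ^ 2) * (μ₂ ^ 2)) + (((1 : ℂ) / 2) * P * bm * θh * (Complex.I ^ 2) * (μ₂ ^ 4)) + ((-16 : ℂ) * P * bm * θh * (m ^ 2) * (ν ^ 2)) + ((-4 : ℂ) * P * bm * θh * (m ^ 2) * (μ₁ ^ 2)) + ((-4 : ℂ) * P * bm * θh * (μ₂ ^ 2) * (ν ^ 2)) + ((-2 : ℂ) * P * bm * lam * θh * (μ₂ ^ 2)) + (4 * P * bm * θh * (m ^ 2) * (μ₂ ^ 2)) + (8 * P * bm * lam * θh * (m ^ 2)) + (8 * P * bm * θh * (Complex.I ^ 2) * (m ^ 4)) + ((-4 : ℂ) * P * bm * θh * (Complex.I ^ 2)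 * (m ^ 2) * (μ₂ ^ 2)) + ((-2 : ℂ) * Complex.I * P * bm * μ₁ * θh * (μ₂ ^ 3)) + (8 * Complex.I * P * bm * μ₁ * μ₂ * θh * (m ^ 2)))) * Complex.I_sq


/-- **The level-`0` step** (pure algebra): with `g₀ = P Y bm`, `f₁ = (κ'+1) P Y bm + P Y² bm₁`,
`f₂ = (κ'+1)² P Y bm + (2κ'+3) P Y² bm₁ + a² P Y³ bm - nq P Y bm` (the closed forms of `g₀, g₀', g₀''`),
`-(2 f₂ - b f₁ + c₀ g₀ + 2(-a²) Y² g₀) = Y (At (P bm) + Bt (P Y bm₁))`. [folklore] -/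
theorem descent_level_zero_algebra {μ₁ μ₂ a m lam Y P bm bm₁ κ' nq At Bt : ℂ}
    (hAt : At = -(2 * (κ' + 1) ^ 2 - 2 * nq - (2 * μ₁ - 2 * m + 4) * (κ' + 1) +
      (μ₁ ^ 2 - Complex.I * μ₁ * μ₂ - μ₂ ^ 2 / 2 + 2 * μ₁ + m ^ 2 / 2 - μ₁ * m - 2 * m - lam)))
    (hBt : Bt = -(4 * (κ' + 1) + 2 - (2 * μ₁ - 2 * m + 4))) :
    -(2 * ((κ' + 1) ^ 2 * (P * Y * bm) + (2 * (κ' + 1) + 1) * (P * Y ^ 2 * bm₁) + (a ^ 2 * (P * Y ^ 3 * bm) - nq * (P * Y * bm))) -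
        (2 * μ₁ - 2 * m + 4) * ((κ' + 1) * (P * Y * bm) + P * Y ^ 2 * bm₁) +
        (μ₁ ^ 2 - Complex.I * μ₁ * μ₂ - μ₂ ^ 2 / 2 + 2 * μ₁ + m ^ 2 / 2 - μ₁ * m - 2 * m - lam) * (P * Y * bm) +
          2 * (-a ^ 2) * Y ^ 2 * (P * Y * bm)) =
      Y * (At * (P * bm) + Bt * (P * Y * bm₁)) := by
  subst hAt hBt
  ring

/-- **The final assembly** (pure algebra): the descent formula
`ℓ(τ(exp yH) x') = (g₁ + 2θ^a Y g₀) - (4m)⁻¹ (8 g₁' - 4μ₁ g₁) - (4m(m-1))⁻¹ (2θ^h Y g₂ - 8(m-1) g₁)` combined with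
the closed forms of `g₀, g₁, g₁', g₁''`, the level-`1` recursion for `g₂` and `descent_algebra`. [folklore] -/
theorem descent_final_algebra {θh θa a m μ₁ μ₂ ν lam Y P bm bm₁ κ' nq At Bt L g₀ g₁ g₁d g₁dd g₂ : ℂ}
    (hθ : θh * θa = -a ^ 2) (hθh : θh ≠ 0) (hm : m ≠ 0) (hm1 : m - 1 ≠ 0)
    (hκ : κ' + 1 = (μ₁ + m + 1) / 2) (hnq : nq = ν ^ 2 + 1 / 4)
    (hAt : At = -(2 * (κ' + 1) ^ 2 - 2 * nq - (2 * μ₁ - 2 * m + 4) * (κ' + 1) +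
      (μ₁ ^ 2 - Complex.I * μ₁ * μ₂ - μ₂ ^ 2 / 2 + 2 * μ₁ + m ^ 2 / 2 - μ₁ * m - 2 * m - lam)))
    (hBt : Bt = -(4 * (κ' + 1) + 2 - (2 * μ₁ - 2 * m + 4)))
    (hL : L = (g₁ + 2 * (θa * Y * g₀)) - (1 / (4 * m)) * (8 * g₁d - 4 * μ₁ * g₁) -
      (1 / (4 * m * (m - 1))) * (2 * (θh * Y * g₂) - 8 * (m - 1) * g₁))
    (hg₀ : g₀ = P * Y * bm)
    (hg₁ : 2 * θh * g₁ = At * (P * bm) + Bt * (P * Y * bm₁))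
    (hg₁d : 2 * θh * g₁d = At * (κ' * (P * bm) + P * Y * bm₁) +
      Bt * ((κ' + 1) * (P * Y * bm₁) + (a ^ 2 * (P * Y ^ 2 * bm) - nq * (P * bm))))
    (hg₁dd : 2 * θh * g₁dd = At * (κ' * (κ' * (P * bm) + P * Y * bm₁) + ((κ' + 1) * (P * Y * bm₁) + (a ^ 2 * (P * Y ^ 2 * bm) - nq * (P * bm)))) +
      Bt * ((κ' + 1) * ((κ' + 1) * (P * Y * bm₁) + (a ^ 2 * (P * Y ^ 2 * bm) - nq * (P * bm))) +
        (a ^ 2 * ((κ' + 2) * (P * Y ^ 2 * bm) + P * Y ^ 3 * bm₁) - nq * (κ' * (P * bm) + P * Y * bm₁))))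
    (hrec : 2 * g₁dd - (2 * μ₁ - 2 * (m - 2) + 4) * g₁d +
      (μ₁ ^ 2 - Complex.I * μ₁ * μ₂ - μ₂ ^ 2 / 2 + 2 * μ₁ + (m - 2) ^ 2 / 2 - μ₁ * (m - 2) - 2 * (m - 2) - lam) * g₁ +
        2 * (θh * θa) * Y ^ 2 * g₁ + 2 * θh * Y * g₂ = 0) :
    L = -((lam - ((μ₁ - Complex.I * μ₂) ^ 2 / 2 - 2 * (ν - Complex.I * m) ^ 2 - 2)) *
          (lam - ((μ₁ - Complex.I * μ₂) ^ 2 / 2 - 2 * (ν + Complex.I * m) ^ 2 - 2))) /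
        (8 * θh * m * (m - 1)) * (P * bm) := by
  have hID := descent_algebra (μ₁ := μ₁) (μ₂ := μ₂) (ν := ν) (θh := θh) (a := a) (m := m) (lam := lam) (Y := Y)
    (P := P) (bm := bm) (bm₁ := bm₁) (κ := κ' + 1) (nq := nq) (At := At) (Bt := Bt) hκ hnq hAt hBt rfl rfl rfl rfl
    rfl rfl rfl
  have hL' : 4 * m * (m - 1) * L = 4 * m * (m - 1) * (g₁ + 2 * (θa * Y * g₀)) - (m - 1) * (8 * g₁d - 4 * μ₁ * g₁) -
      (2 * (θh * Y * g₂) - 8 * (m - 1) * g₁) := by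
    rw [hL]
    field_simp
  have hmain : (2 * θh) ^ 2 * (4 * m * (m - 1) * L) =
      -2 * θh * (lam - ((μ₁ - Complex.I * μ₂) ^ 2 / 2 - 2 * (ν - Complex.I * m) ^ 2 - 2)) *
        (lam - ((μ₁ - Complex.I * μ₂) ^ 2 / 2 - 2 * (ν + Complex.I * m) ^ 2 - 2)) * (P * bm) := by
    linear_combination (2 * θh) ^ 2 * hL' + hID +
      (2 * θh * (4 * m * (m - 1) + 4 * μ₁ * (m - 1) + 8 * (m - 1)) +
        2 * θh * ((μ₁ ^ 2 - Complex.I * μ₁ * μ₂ - μ₂ ^ 2 / 2 + 2 * μ₁ + (m - 2) ^ 2 / 2 - μ₁ * (m - 2) - 2 * (m - 2) - lam) +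
          2 * θh * θa * Y ^ 2)) * hg₁ +
      (-16 * θh * (m - 1) - 2 * θh * (2 * μ₁ - 2 * (m - 2) + 4)) * hg₁d + (4 * θh) * hg₁dd + (-4 * θh ^ 2) * hrec +
      (4 * θh * Y ^ 2 * (At * (P * bm) + Bt * (P * Y * bm₁)) + 32 * m * (m - 1) * θh * P * Y ^ 2 * bm) * hθ +
      (32 * m * (m - 1) * θh ^ 2 * θa * Y) * hg₀
  have hden : (2 * θh) ^ 2 * (4 * m * (m - 1)) ≠ 0 :=
    mul_ne_zero (pow_ne_zero 2 (mul_ne_zero two_ne_zero hθh)) (mul_ne_zero (mul_ne_zero (by norm_num) hm) hm1)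
  have hLsol : L = -2 * θh * (lam - ((μ₁ - Complex.I * μ₂) ^ 2 / 2 - 2 * (ν - Complex.I * m) ^ 2 - 2)) *
      (lam - ((μ₁ - Complex.I * μ₂) ^ 2 / 2 - 2 * (ν + Complex.I * m) ^ 2 - 2)) * (P * bm) / ((2 * θh) ^ 2 * (4 * m * (m - 1))) := by
    rw [eq_div_iff hden, ← hmain]
    ring
  rw [hLsol]
  field_simp
  ring

/-! ### 2. Calculus of the monomials `(e^t)^κ (e^t)^k besselMode(₁)` -/

section Calculus

/-- `t ↦ (e^t)^k` (natural power of the real exponential, as a complex function) has derivative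
`k (e^y)^k`. [folklore] -/
theorem hasDerivAt_ofReal_exp_pow (k : ℕ) (y : ℝ) :
    HasDerivAt (fun t : ℝ => ((Real.exp t : ℝ) : ℂ) ^ k) ((k : ℂ) * ((Real.exp y : ℝ) : ℂ) ^ k) y := by
  have h := ((Real.hasDerivAt_exp y).ofReal_comp).pow k
  refine h.congr_deriv ?_
  rcases k with _ | k
  · simp
  · push_cast
    ring

/-- **Derivative of `t ↦ (e^t)^κ (e^t)^k besselMode a w (e^t)`**. [folklore] -/
theorem hasDerivAt_cpow_pow_mul_besselMode_exp {a : ℝ} (ha : 0 < a) (κ w : ℂ) (k : ℕ) (y : ℝ) :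
    HasDerivAt (fun t : ℝ => ((Real.exp t : ℝ) : ℂ) ^ κ * ((Real.exp t : ℝ) : ℂ) ^ k * besselMode a w (Real.exp t))
      ((κ + k) * (((Real.exp y : ℝ) : ℂ) ^ κ * ((Real.exp y : ℝ) : ℂ) ^ k * besselMode a w (Real.exp y)) +
        ((Real.exp y : ℝ) : ℂ) ^ κ * ((Real.exp y : ℝ) : ℂ) ^ (k + 1) * besselMode₁ a w (Real.exp y)) y := by
  have h1 : HasDerivAt (fun t : ℝ => ((Real.exp t : ℝ) : ℂ) ^ κ) (κ * ((Real.exp y : ℝ) : ℂ) ^ κ) y := by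
    have hfun : (fun t : ℝ => ((Real.exp t : ℝ) : ℂ) ^ κ) = fun t : ℝ => Complex.exp (κ * t) := by
      funext t; exact ofReal_exp_cpow t κ
    rw [hfun, ofReal_exp_cpow]
    have h : HasDerivAt (fun t : ℝ => κ * (t : ℂ)) (κ * 1) y := ((hasDerivAt_id y).ofReal_comp).const_mul κ
    simpa [mul_comm] using h.cexp
  have h2 := hasDerivAt_ofReal_exp_pow k y
  have h3 : HasDerivAt (fun t : ℝ => besselMode a w (Real.exp t)) (Real.exp y • besselMode₁ a w (Real.exp y)) y :=
    (hasDerivAt_besselMode w (Real.exp_pos y) ha).scomp y (Real.hasDerivAt_exp y)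
  refine ((h1.mul h2).mul h3).congr_deriv ?_
  simp only [Pi.mul_apply]
  rw [Complex.real_smul, pow_succ]
  push_cast
  ring

/-- **Derivative of `t ↦ (e^t)^κ (e^t)^(k+1) besselMode₁ a w (e^t)`** (`besselMode₁' = (a² - (w²+¼)/y²) besselMode`),
in division-free form. [folklore] -/
theorem hasDerivAt_cpow_pow_mul_besselMode₁_exp {a : ℝ} (ha : 0 < a) (κ w : ℂ) (k : ℕ) (y : ℝ) :
    HasDerivAt (fun t : ℝ => ((Real.exp t : ℝ) : ℂ) ^ κ * ((Real.exp t : ℝ) : ℂ) ^ (k + 1) * besselMode₁ a w (Real.exp t))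
      ((κ + (k + 1)) * (((Real.exp y : ℝ) : ℂ) ^ κ * ((Real.exp y : ℝ) : ℂ) ^ (k + 1) * besselMode₁ a w (Real.exp y)) +
        ((a : ℂ) ^ 2 * (((Real.exp y : ℝ) : ℂ) ^ κ * ((Real.exp y : ℝ) : ℂ) ^ (k + 2) * besselMode a w (Real.exp y)) -
          (w ^ 2 + 1 / 4) * (((Real.exp y : ℝ) : ℂ) ^ κ * ((Real.exp y : ℝ) : ℂ) ^ k * besselMode a w (Real.exp y)))) y := by
  have h1 : HasDerivAt (fun t : ℝ => ((Real.exp t : ℝ) : ℂ) ^ κ) (κ * ((Real.exp y : ℝ) : ℂ) ^ κ) y := by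
    have hfun : (fun t : ℝ => ((Real.exp t : ℝ) : ℂ) ^ κ) = fun t : ℝ => Complex.exp (κ * t) := by
      funext t; exact ofReal_exp_cpow t κ
    rw [hfun, ofReal_exp_cpow]
    have h : HasDerivAt (fun t : ℝ => κ * (t : ℂ)) (κ * 1) y := ((hasDerivAt_id y).ofReal_comp).const_mul κ
    simpa [mul_comm] using h.cexp
  have h2 := hasDerivAt_ofReal_exp_pow (k + 1) y
  have h3 : HasDerivAt (fun t : ℝ => besselMode₁ a w (Real.exp t))
      (Real.exp y • (((a : ℂ) ^ 2 - (w ^ 2 + 1 / 4) / (Real.exp y : ℂ) ^ 2) * besselMode a w (Real.exp y))) y :=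
    (hasDerivAt_besselMode₁ w (Real.exp_pos y) ha).scomp y (Real.hasDerivAt_exp y)
  refine ((h1.mul h2).mul h3).congr_deriv ?_
  have hY : ((Real.exp y : ℝ) : ℂ) ≠ 0 := Complex.ofReal_ne_zero.mpr (Real.exp_pos y).ne'
  simp only [Pi.mul_apply]
  rw [Complex.real_smul]
  field_simp
  push_cast
  ring

end Calculus

/-! ### 3. The Kirillov function of the descent vector -/

section Descent

variable {hcpt : isCompact_glFiniteIntegralLevel 2 K}
  {E : Type*} [NormedAddCommGroup E] [NormedSpace ℂ E] [CompleteSpace E]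
  {τ : ContRepresentation ℂ (AutomorphyDatum.gl 2 K hcpt).arch.carrier E}
  (hτ : τ.IsStronglyContinuous) (w : {w : InfinitePlace K // IsComplex w})

local notation "𝐜" => ((0, Pi.single w 1) : mixedSpace K)
local notation "𝐜I" => ((0, Pi.single w Complex.I) : mixedSpace K)
local notation "Hc" => Matrix.single (0 : Fin 2) (0 : Fin 2) ((0, Pi.single w 1) : mixedSpace K)
local notation "D" => gardingEnd (hcpt := hcpt) (τ := τ) hτ
local notation "A[" y "]" => gardingAct (hcpt := hcpt) (τ := τ) hτ (expGL ((y : ℝ) • Hc))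
local notation "Dh[" i "," j "]" => (gardingEnd (hcpt := hcpt) (τ := τ) hτ (Matrix.single (i : Fin 2) (j : Fin 2) ((0, Pi.single w 1) : mixedSpace K)) -
  Complex.I • gardingEnd (hcpt := hcpt) (τ := τ) hτ (Matrix.single (i : Fin 2) (j : Fin 2) ((0, Pi.single w Complex.I) : mixedSpace K)))
local notation "Da[" i "," j "]" => (gardingEnd (hcpt := hcpt) (τ := τ) hτ (Matrix.single (i : Fin 2) (j : Fin 2) ((0, Pi.single w 1) : mixedSpace K)) +
  Complex.I • gardingEnd (hcpt := hcpt) (τ := τ) hτ (Matrix.single (i : Fin 2) (j : Fin 2) ((0, Pi.single w Complex.I) : mixedSpace K)))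
local notation "Tc" => (Matrix.single (0 : Fin 2) (0 : Fin 2) ((0, Pi.single w Complex.I) : mixedSpace K) -
  Matrix.single (1 : Fin 2) (1 : Fin 2) ((0, Pi.single w Complex.I) : mixedSpace K))

/-- `ℓ(τ(exp yH) τ^a(E₀₁) v) = (θ₁ + iθ₂) e^y ℓ(τ(exp yH) v)` and
`ℓ(τ(exp yH) τ^h(E₀₁) v) = (θ₁ - iθ₂) e^y ℓ(τ(exp yH) v)`. [folklore] -/
theorem apply_gardingAct_anti01_hol01 {ℓ : archGardingSpace hcpt τ →ₗ[ℂ] ℂ} {θ₁ θ₂ : ℂ}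
    (hθ₁ : ∀ u : archGardingSpace hcpt τ, ℓ (D (Matrix.single 0 1 𝐜) u) = θ₁ * ℓ u)
    (hθ₂ : ∀ u : archGardingSpace hcpt τ, ℓ (D (Matrix.single 0 1 𝐜I) u) = θ₂ * ℓ u)
    (v : archGardingSpace hcpt τ) (y : ℝ) :
    ℓ (A[y] (Da[0,1] v)) = (θ₁ + Complex.I * θ₂) * (Real.exp y : ℂ) * ℓ (A[y] v) ∧
    ℓ (A[y] (Dh[0,1] v)) = (θ₁ - Complex.I * θ₂) * (Real.exp y : ℂ) * ℓ (A[y] v) := by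
  obtain ⟨hh, ha⟩ := gardingAct_expGLC_mul_hol01 (hcpt := hcpt) (τ := τ) hτ w y
  refine ⟨?_, ?_⟩
  · have h := LinearMap.congr_fun ha v
    rw [Module.End.mul_apply] at h
    rw [h, LinearMap.smul_apply, map_smul, Module.End.mul_apply, LinearMap.add_apply, LinearMap.smul_apply, map_add,
      map_smul, hθ₁, hθ₂, smul_eq_mul, smul_eq_mul]
    ring
  · have h := LinearMap.congr_fun hh v
    rw [Module.End.mul_apply] at h
    rw [h, LinearMap.smul_apply, map_smul, Module.End.mul_apply, LinearMap.sub_apply, LinearMap.smul_apply, map_sub,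
      map_smul, hθ₁, hθ₂, smul_eq_mul, smul_eq_mul]
    ring

/-- `P⁰ v = 8 τ(H) v - 4μ₁ v` for the operator `P⁰ = 2(τ^h(E₀₀) - τ^h(E₁₁)) + 2(τ^a(E₀₀) - τ^a(E₁₁))` of
the descent formula, when the centre `E₀₀ ⊗ c + E₁₁ ⊗ c` acts on `v` by `μ₁`. [folklore] -/
theorem pZero_apply_eq (μ₁ : ℂ) (v : archGardingSpace hcpt τ)
    (hZ1 : D (Matrix.single 0 0 𝐜 + Matrix.single 1 1 𝐜) v = μ₁ • v) :
    ((2 : ℂ) • (Dh[0,0] - Dh[1,1]) + (2 : ℂ) • (Da[0,0] - Da[1,1])) v = (8 : ℂ) • D Hc v - (4 * μ₁) • v := by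
  rw [gardingEnd_add, LinearMap.add_apply] at hZ1
  have h11 : D (Matrix.single 1 1 𝐜) v = μ₁ • v - D Hc v := by rw [← hZ1]; abel
  simp only [LinearMap.add_apply, LinearMap.sub_apply, LinearMap.smul_apply, h11]
  module

set_option maxHeartbeats 800000 in
-- the many `τ(exp yH)`-statements each pay for instance unification on `GL₂(K_∞)`
/-- **The Kirillov function of the descent vector.** In the setting of
`exists_forall_apply_loweringK_pow_eq_besselMode` but WITHOUT the minimal-type relation: `x` a highest-weight
Gårding vector of torus weight `m` (`m ≠ 0, 1`) at the complex place `w`, centre `μ₁, μ₂`, antiholomorphic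
Casimir `λ_a = (μ₁+iμ₂)²/2 - 2ν² - 2` on `x`, holomorphic Casimir `λ_h` on `𝒢`, `τ` contractive, `ℓ` continuous
for the `U(𝔤)`-seminorms with `ℓ ∘ τ(E₀₁ ⊗ c) = θ₁ ℓ`, `ℓ ∘ τ(E₀₁ ⊗ ic) = θ₂ ℓ`, `(θ₁+iθ₂)(θ₁-iθ₂) = -a²`. Then,
with the constant `c` of `ℓ(τ(exp yH) x) = c (e^y)^{(μ₁+m+1)/2} besselMode a ν (e^y)`, the descent vector
`x' = P⁻ x - (4m)⁻¹ P⁰ F x - (4m(m-1))⁻¹ P⁺ F² x` of `ArchKTypeDescentGL2Complex.descent_highest` has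

  `ℓ(τ(exp yH) x') = c · (-(λ_h - Λ₊)(λ_h - Λ₋) / (8 (θ₁ - iθ₂) m (m-1))) · (e^y)^{(μ₁+m+1)/2 - 1} besselMode a ν (e^y)`,

`Λ_± = (μ₁ - iμ₂)²/2 - 2(ν ∓ im)² - 2` (two steps of `kirillovODE_complex_string_down` and `descent_algebra`).
[cite: JacquetLanglands1970, §6] [cite: Knapp1986, Ch. VIII §3] -/
theorem exists_apply_gardingAct_descent_eq (hτb : ∀ g, ‖(τ g : E →L[ℂ] E)‖ ≤ 1)
    {ℓ : archGardingSpace hcpt τ →ₗ[ℂ] ℂ}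
    (hℓ : ∃ (C : ℝ) (𝒮 : Finset (List (Matrix (Fin 2) (Fin 2) (mixedSpace K)))), 0 ≤ C ∧
      ∀ v : archGardingSpace hcpt τ, ‖ℓ v‖ ≤ C * ∑ w ∈ 𝒮, ‖archWordDerivE hcpt τ w v‖)
    {θ₁ θ₂ : ℂ} (hθ₁ : ∀ u : archGardingSpace hcpt τ, ℓ (D (Matrix.single 0 1 𝐜) u) = θ₁ * ℓ u)
    (hθ₂ : ∀ u : archGardingSpace hcpt τ, ℓ (D (Matrix.single 0 1 𝐜I) u) = θ₂ * ℓ u)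
    {a : ℝ} (ha : 0 < a) (hθa : (θ₁ + Complex.I * θ₂) * (θ₁ - Complex.I * θ₂) = -((a : ℂ) ^ 2))
    (μ₁ μ₂ m : ℂ) (hm : m ≠ 0) (hm1 : m - 1 ≠ 0) (lama lamh ν : ℂ)
    (hlama : lama = (μ₁ + Complex.I * μ₂) ^ 2 / 2 - 2 * ν ^ 2 - 2)
    (x : archGardingSpace hcpt τ) (hE : (Dh[0,1] - Da[1,0]) x = 0) (hT : D Tc x = (Complex.I * m) • x)
    (hZ1 : ∀ v : archGardingSpace hcpt τ, D (Matrix.single 0 0 𝐜 + Matrix.single 1 1 𝐜) v = μ₁ • v)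
    (hZ2 : ∀ v : archGardingSpace hcpt τ, D (Matrix.single 0 0 𝐜I + Matrix.single 1 1 𝐜I) v = μ₂ • v)
    (hCa : ∑ i : Fin 2, ∑ j : Fin 2, Da[i,j] (Da[j,i] x) = lama • x)
    (hCh : ∀ v : archGardingSpace hcpt τ, ∑ i : Fin 2, ∑ j : Fin 2, Dh[i,j] (Dh[j,i] v) = lamh • v) :
    ∃ c : ℂ, (∀ y : ℝ, ℓ (A[y] x) = c * (Real.exp y : ℂ) ^ ((μ₁ + m + 1) / 2) * besselMode a ν (Real.exp y)) ∧
      ∀ y : ℝ, ℓ (A[y] ((Dh[1,0] + Da[0,1]) x -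
          (1 / (4 * m)) • ((2 : ℂ) • (Dh[0,0] - Dh[1,1]) + (2 : ℂ) • (Da[0,0] - Da[1,1])) ((Dh[1,0] - Da[0,1]) x) -
          (1 / (4 * m * (m - 1))) • (Dh[0,1] + Da[1,0]) ((Dh[1,0] - Da[0,1]) ((Dh[1,0] - Da[0,1]) x)))) =
        c * (-((lamh - ((μ₁ - Complex.I * μ₂) ^ 2 / 2 - 2 * (ν - Complex.I * m) ^ 2 - 2)) *
              (lamh - ((μ₁ - Complex.I * μ₂) ^ 2 / 2 - 2 * (ν + Complex.I * m) ^ 2 - 2))) /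
            (8 * (θ₁ - Complex.I * θ₂) * m * (m - 1))) *
          (Real.exp y : ℂ) ^ ((μ₁ + m + 1) / 2 - 1) * besselMode a ν (Real.exp y) := by
  -- the highest-weight vector itself: `ℓ(τ(exp yH) x) = c Y^κ besselMode`
  have hR : D (Matrix.single 0 1 𝐜 - Matrix.single 1 0 𝐜) x -
      Complex.I • D (Matrix.single 0 1 𝐜I + Matrix.single 1 0 𝐜I) x = 0 := by
    have h := LinearMap.congr_fun (raisingK_loweringK_eq (hcpt := hcpt) (τ := τ) hτ w).1 x
    rw [hE] at h
    rw [LinearMap.sub_apply, LinearMap.smul_apply] at h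
    exact h.symm
  obtain ⟨c, hc⟩ := exists_apply_gardingAct_expGLC_eq_besselMode_of_highest hτ w hτb hℓ hθ₁ hθ₂ ha hθa μ₁ μ₂ m lama
    ν hlama x hR hT (hZ1 x) (hZ2 x) hCa
  refine ⟨c, hc, fun y => ?_⟩
  -- non-vanishing constants
  have hθh : θ₁ - Complex.I * θ₂ ≠ 0 := by
    intro h0
    rw [h0, mul_zero] at hθa
    exact pow_ne_zero 2 (Complex.ofReal_ne_zero.mpr ha.ne') (neg_eq_zero.mp hθa.symm)
  have hθ' : (θ₁ - Complex.I * θ₂) * (θ₁ + Complex.I * θ₂) = -((a : ℂ) ^ 2) := by rw [mul_comm]; exact hθa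
  have h2θ : 2 * (θ₁ - Complex.I * θ₂) ≠ 0 := mul_ne_zero two_ne_zero hθh
  -- the string `v₁ = F x`, `v₂ = F v₁`
  obtain ⟨v₁, hv₁⟩ : ∃ v₁ : archGardingSpace hcpt τ, (Dh[1,0] - Da[0,1]) x = v₁ := ⟨_, rfl⟩
  obtain ⟨v₂, hv₂⟩ : ∃ v₂ : archGardingSpace hcpt τ, (Dh[1,0] - Da[0,1]) v₁ = v₂ := ⟨_, rfl⟩
  rw [hv₁, hv₂]
  have hT₁ : D Tc v₁ = (Complex.I * (m - 2)) • v₁ := by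
    have h := torusC_loweringK_pow_apply hτ w m x hT 1
    simpa only [pow_one, hv₁, Nat.cast_one, mul_one] using h
  have hEv₂ : (Dh[0,1] - Da[1,0]) v₂ = (8 * (m - 1)) • v₁ := by
    have h := raisingK_loweringK_pow_succ_apply hτ w m x hE hT 1
    rw [pow_succ, pow_one, Module.End.mul_apply, hv₁, hv₂] at h
    rw [h]
    congr 1
    push_cast
    ring
  -- the exponent `κ' = κ - 1` and the monomials
  obtain ⟨κ', hκ'⟩ : ∃ κ' : ℂ, κ' = (μ₁ + m + 1) / 2 - 1 := ⟨_, rfl⟩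
  have hκ : κ' + 1 = (μ₁ + m + 1) / 2 := by rw [hκ']; ring
  obtain ⟨nq, hnq⟩ : ∃ nq : ℂ, nq = ν ^ 2 + 1 / 4 := ⟨_, rfl⟩
  obtain ⟨Φ1, hΦ1⟩ : ∃ Φ1 : ℕ → ℝ → ℂ,
      Φ1 = fun k t => ((Real.exp t : ℝ) : ℂ) ^ κ' * ((Real.exp t : ℝ) : ℂ) ^ k * besselMode a ν (Real.exp t) := ⟨_, rfl⟩
  obtain ⟨Φ2, hΦ2⟩ : ∃ Φ2 : ℕ → ℝ → ℂ,
      Φ2 = fun k t => ((Real.exp t : ℝ) : ℂ) ^ κ' * ((Real.exp t : ℝ) : ℂ) ^ k * besselMode₁ a ν (Real.exp t) := ⟨_, rfl⟩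
  have hd1 : ∀ (k : ℕ) (t : ℝ), HasDerivAt (Φ1 k) ((κ' + k) * Φ1 k t + Φ2 (k + 1) t) t := fun k t => by
    rw [hΦ1, hΦ2]
    exact hasDerivAt_cpow_pow_mul_besselMode_exp ha κ' ν k t
  have hd2 : ∀ (k : ℕ) (t : ℝ), HasDerivAt (Φ2 (k + 1))
      ((κ' + (k + 1)) * Φ2 (k + 1) t + ((a : ℂ) ^ 2 * Φ1 (k + 2) t - nq * Φ1 k t)) t := fun k t => by
    rw [hΦ1, hΦ2, hnq]
    exact hasDerivAt_cpow_pow_mul_besselMode₁_exp ha κ' ν k t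
  -- `g₀ = c Φ1 1`
  have hg₀ : ∀ t : ℝ, ℓ (A[t] x) = c * Φ1 1 t := fun t => by
    rw [hc t, hΦ1]
    simp only [pow_one]
    rw [← hκ, Complex.cpow_add _ _ (Complex.ofReal_ne_zero.mpr (Real.exp_pos t).ne'), Complex.cpow_one]
    ring
  have hg₀fun : (fun t : ℝ => ℓ (A[t] x)) = fun t : ℝ => c * Φ1 1 t := funext hg₀
  -- `f₁ = g₀'`, `f₂ = g₀''`
  have hf₁ : ∀ t : ℝ, ℓ (A[t] (D Hc x)) = c * ((κ' + 1) * Φ1 1 t + Φ2 2 t) := fun t => by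
    have h1 : HasDerivAt (fun s : ℝ => ℓ (A[s] x)) (ℓ (A[t] (D Hc x))) t := hasDerivAt_apply_gardingAct_expGLC hτ w hℓ x t
    rw [hg₀fun] at h1
    have h := h1.unique ((hd1 1 t).const_mul c)
    rw [h]
    push_cast
    ring
  have hf₁fun : (fun t : ℝ => ℓ (A[t] (D Hc x))) = fun t : ℝ => c * ((κ' + 1) * Φ1 1 t + Φ2 2 t) := funext hf₁
  have hf₂ : ∀ t : ℝ, ℓ (A[t] (D Hc (D Hc x))) =
      c * ((κ' + 1) * ((κ' + 1) * Φ1 1 t + Φ2 2 t) + ((κ' + 2) * Φ2 2 t + ((a : ℂ) ^ 2 * Φ1 3 t - nq * Φ1 1 t))) :=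
    fun t => by
    have h1 : HasDerivAt (fun s : ℝ => ℓ (A[s] (D Hc x))) (ℓ (A[t] (D Hc (D Hc x)))) t :=
      hasDerivAt_apply_gardingAct_expGLC hτ w hℓ (D Hc x) t
    rw [hf₁fun] at h1
    have h := h1.unique ((((hd1 1 t).const_mul (κ' + 1)).add (hd2 1 t)).const_mul c)
    rw [h]
    push_cast
    ring
  -- level `0`: `2θ^h g₁ = c (At Φ1 0 + Bt Φ2 1)`
  obtain ⟨At, hAt⟩ : ∃ At : ℂ, At = -(2 * (κ' + 1) ^ 2 - 2 * nq - (2 * μ₁ - 2 * m + 4) * (κ' + 1) +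
      (μ₁ ^ 2 - Complex.I * μ₁ * μ₂ - μ₂ ^ 2 / 2 + 2 * μ₁ + m ^ 2 / 2 - μ₁ * m - 2 * m - lamh)) := ⟨_, rfl⟩
  obtain ⟨Bt, hBt⟩ : ∃ Bt : ℂ, Bt = -(4 * (κ' + 1) + 2 - (2 * μ₁ - 2 * m + 4)) := ⟨_, rfl⟩
  have hg₁ : ∀ t : ℝ, 2 * (θ₁ - Complex.I * θ₂) * ℓ (A[t] v₁) = c * (At * Φ1 0 t + Bt * Φ2 1 t) := fun t => by
    have hY : ((Real.exp t : ℝ) : ℂ) ≠ 0 := Complex.ofReal_ne_zero.mpr (Real.exp_pos t).ne'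
    have hrec := kirillovODE_complex_string_down hτ w hθ₁ hθ₂ μ₁ μ₂ m lamh x v₁ hv₁ hT (hZ1 x) (hZ2 x) (hCh x) t
    rw [hg₀ t, hf₁ t, hf₂ t] at hrec
    have halg := descent_level_zero_algebra (μ₁ := μ₁) (μ₂ := μ₂) (a := (a : ℂ)) (m := m) (lam := lamh)
      (Y := ((Real.exp t : ℝ) : ℂ)) (P := ((Real.exp t : ℝ) : ℂ) ^ κ') (bm := c * besselMode a ν (Real.exp t))
      (bm₁ := c * besselMode₁ a ν (Real.exp t)) (κ' := κ') (nq := nq) hAt hBt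
    refine mul_left_cancel₀ hY ?_
    rw [hΦ1, hΦ2] at hrec
    rw [hΦ1, hΦ2]
    simp only [pow_zero, pow_one, mul_one] at hrec halg ⊢
    linear_combination hrec + halg - 2 * ((Real.exp t : ℝ) : ℂ) ^ 2 *
      (c * (((Real.exp t : ℝ) : ℂ) ^ κ' * ((Real.exp t : ℝ) : ℂ) * besselMode a ν (Real.exp t))) * hθ'
  have hg₁fun : (fun t : ℝ => ℓ (A[t] v₁)) = fun t : ℝ => (2 * (θ₁ - Complex.I * θ₂))⁻¹ * (c * (At * Φ1 0 t + Bt * Φ2 1 t)) :=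
    funext fun t => (eq_inv_mul_iff_mul_eq₀ h2θ).mpr (hg₁ t)
  -- `g₁'`
  have hg₁d : ∀ t : ℝ, 2 * (θ₁ - Complex.I * θ₂) * ℓ (A[t] (D Hc v₁)) =
      c * (At * (κ' * Φ1 0 t + Φ2 1 t) + Bt * ((κ' + 1) * Φ2 1 t + ((a : ℂ) ^ 2 * Φ1 2 t - nq * Φ1 0 t))) := fun t => by
    have h1 : HasDerivAt (fun s : ℝ => ℓ (A[s] v₁)) (ℓ (A[t] (D Hc v₁))) t := hasDerivAt_apply_gardingAct_expGLC hτ w hℓ v₁ t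
    rw [hg₁fun] at h1
    have h := h1.unique (((((hd1 0 t).const_mul At).add ((hd2 0 t).const_mul Bt)).const_mul c).const_mul
      (2 * (θ₁ - Complex.I * θ₂))⁻¹)
    rw [h, mul_inv_cancel_left₀ h2θ]
    push_cast
    ring
  have hg₁dfun : (fun t : ℝ => ℓ (A[t] (D Hc v₁))) = fun t : ℝ => (2 * (θ₁ - Complex.I * θ₂))⁻¹ *
      (c * (At * (κ' * Φ1 0 t + Φ2 1 t) + Bt * ((κ' + 1) * Φ2 1 t + ((a : ℂ) ^ 2 * Φ1 2 t - nq * Φ1 0 t)))) :=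
    funext fun t => (eq_inv_mul_iff_mul_eq₀ h2θ).mpr (hg₁d t)
  -- `g₁''` at `y`
  have hg₁dd : 2 * (θ₁ - Complex.I * θ₂) * ℓ (A[y] (D Hc (D Hc v₁))) =
      c * (At * (κ' * (κ' * Φ1 0 y + Φ2 1 y) + ((κ' + 1) * Φ2 1 y + ((a : ℂ) ^ 2 * Φ1 2 y - nq * Φ1 0 y))) +
        Bt * ((κ' + 1) * ((κ' + 1) * Φ2 1 y + ((a : ℂ) ^ 2 * Φ1 2 y - nq * Φ1 0 y)) +
          ((a : ℂ) ^ 2 * ((κ' + 2) * Φ1 2 y + Φ2 3 y) - nq * (κ' * Φ1 0 y + Φ2 1 y)))) := by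
    have h1 : HasDerivAt (fun s : ℝ => ℓ (A[s] (D Hc v₁))) (ℓ (A[y] (D Hc (D Hc v₁)))) y :=
      hasDerivAt_apply_gardingAct_expGLC hτ w hℓ (D Hc v₁) y
    rw [hg₁dfun] at h1
    have hA' := (((hd1 0 y).const_mul κ').add (hd2 0 y)).const_mul At
    have hB' := ((((hd2 0 y).const_mul (κ' + 1)).add
      ((((hd1 2 y).const_mul ((a : ℂ) ^ 2)).sub ((hd1 0 y).const_mul nq))))).const_mul Bt
    have h := h1.unique (((hA'.add hB').const_mul c).const_mul (2 * (θ₁ - Complex.I * θ₂))⁻¹)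
    rw [h, mul_inv_cancel_left₀ h2θ]
    push_cast
    ring
  -- level `1`: the recursion for `g₂`
  have hrec1 := kirillovODE_complex_string_down hτ w hθ₁ hθ₂ μ₁ μ₂ (m - 2) lamh v₁ v₂ hv₂ hT₁ (hZ1 v₁) (hZ2 v₁) (hCh v₁) y
  -- the three pieces of `ℓ(τ(exp yH) x')`
  have hPm : ℓ (A[y] ((Dh[1,0] + Da[0,1]) x)) =
      ℓ (A[y] v₁) + 2 * ((θ₁ + Complex.I * θ₂) * (Real.exp y : ℂ) * ℓ (A[y] x)) := by
    have hx : (Dh[1,0] + Da[0,1]) x = v₁ + (2 : ℂ) • Da[0,1] x := by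
      rw [← hv₁]
      simp only [LinearMap.add_apply, LinearMap.sub_apply, LinearMap.smul_apply]
      module
    rw [hx, map_add, map_smul, map_add, map_smul, (apply_gardingAct_anti01_hol01 hτ w hθ₁ hθ₂ x y).1, smul_eq_mul]
  have hP0 : ℓ (A[y] (((2 : ℂ) • (Dh[0,0] - Dh[1,1]) + (2 : ℂ) • (Da[0,0] - Da[1,1])) v₁)) =
      8 * ℓ (A[y] (D Hc v₁)) - 4 * μ₁ * ℓ (A[y] v₁) := by
    rw [pZero_apply_eq hτ w μ₁ v₁ (hZ1 v₁), map_sub, map_smul, map_smul, map_sub, map_smul, map_smul, smul_eq_mul,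
      smul_eq_mul]
  have hPp : ℓ (A[y] ((Dh[0,1] + Da[1,0]) v₂)) =
      2 * ((θ₁ - Complex.I * θ₂) * (Real.exp y : ℂ) * ℓ (A[y] v₂)) - 8 * (m - 1) * ℓ (A[y] v₁) := by
    have hx2 : (Dh[0,1] + Da[1,0]) v₂ = (2 : ℂ) • Dh[0,1] v₂ - (8 * (m - 1)) • v₁ := by
      rw [← hEv₂]
      simp only [LinearMap.add_apply, LinearMap.sub_apply, LinearMap.smul_apply]
      module
    rw [hx2, map_sub, map_smul, map_smul, map_sub, map_smul, map_smul, (apply_gardingAct_anti01_hol01 hτ w hθ₁ hθ₂ v₂ y).2,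
      smul_eq_mul, smul_eq_mul]
  have hL : ℓ (A[y] ((Dh[1,0] + Da[0,1]) x -
      (1 / (4 * m)) • ((2 : ℂ) • (Dh[0,0] - Dh[1,1]) + (2 : ℂ) • (Da[0,0] - Da[1,1])) v₁ -
        (1 / (4 * m * (m - 1))) • (Dh[0,1] + Da[1,0]) v₂)) =
      (ℓ (A[y] v₁) + 2 * ((θ₁ + Complex.I * θ₂) * (Real.exp y : ℂ) * ℓ (A[y] x))) -
        (1 / (4 * m)) * (8 * ℓ (A[y] (D Hc v₁)) - 4 * μ₁ * ℓ (A[y] v₁)) -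
          (1 / (4 * m * (m - 1))) * (2 * ((θ₁ - Complex.I * θ₂) * (Real.exp y : ℂ) * ℓ (A[y] v₂)) - 8 * (m - 1) * ℓ (A[y] v₁)) := by
    rw [map_sub, map_sub, map_smul, map_smul, map_sub, map_sub, map_smul, map_smul, hPm, hP0, hPp, smul_eq_mul, smul_eq_mul]
  -- assemble
  have hfin := descent_final_algebra (θh := θ₁ - Complex.I * θ₂) (θa := θ₁ + Complex.I * θ₂) (a := (a : ℂ)) (m := m)
    (μ₁ := μ₁) (μ₂ := μ₂) (ν := ν) (lam := lamh) (Y := ((Real.exp y : ℝ) : ℂ)) (P := ((Real.exp y : ℝ) : ℂ) ^ κ')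
    (bm := c * besselMode a ν (Real.exp y)) (bm₁ := c * besselMode₁ a ν (Real.exp y)) (κ' := κ') (nq := nq)
    (At := At) (Bt := Bt) (L := _) (g₀ := ℓ (A[y] x)) (g₁ := ℓ (A[y] v₁)) (g₁d := ℓ (A[y] (D Hc v₁)))
    (g₁dd := ℓ (A[y] (D Hc (D Hc v₁)))) (g₂ := ℓ (A[y] v₂)) hθ' hθh hm hm1 hκ hnq hAt hBt hL
    (by rw [hg₀ y, hΦ1]; simp only [pow_one]; ring)
    (by rw [hg₁ y, hΦ1, hΦ2]; simp only [pow_zero, pow_one, mul_one]; ring)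
    (by rw [hg₁d y, hΦ1, hΦ2]; simp only [pow_zero, pow_one, mul_one]; ring)
    (by rw [hg₁dd, hΦ1, hΦ2]; simp only [pow_zero, pow_one, mul_one]; ring)
    hrec1
  rw [hfin, hκ']
  ring

/-- **Minimal type from the vanishing of the descent.** In the situation of
`exists_apply_gardingAct_descent_eq`, if the Kirillov function of the descent vector `x'` along `exp(ℝ H)`
vanishes identically while that of `x` does not, then the string of `x` is of minimal type:
`λ_h = (μ₁ - iμ₂)²/2 - 2(ν - im)² - 2` or `λ_h = (μ₁ - iμ₂)²/2 - 2(ν + im)² - 2`.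
[cite: JacquetLanglands1970, §6] [cite: Knapp1986, Ch. VIII §3] -/
theorem minimalType_of_apply_gardingAct_descent_eq_zero (hτb : ∀ g, ‖(τ g : E →L[ℂ] E)‖ ≤ 1)
    {ℓ : archGardingSpace hcpt τ →ₗ[ℂ] ℂ}
    (hℓ : ∃ (C : ℝ) (𝒮 : Finset (List (Matrix (Fin 2) (Fin 2) (mixedSpace K)))), 0 ≤ C ∧
      ∀ v : archGardingSpace hcpt τ, ‖ℓ v‖ ≤ C * ∑ w ∈ 𝒮, ‖archWordDerivE hcpt τ w v‖)
    {θ₁ θ₂ : ℂ} (hθ₁ : ∀ u : archGardingSpace hcpt τ, ℓ (D (Matrix.single 0 1 𝐜) u) = θ₁ * ℓ u)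
    (hθ₂ : ∀ u : archGardingSpace hcpt τ, ℓ (D (Matrix.single 0 1 𝐜I) u) = θ₂ * ℓ u)
    {a : ℝ} (ha : 0 < a) (hθa : (θ₁ + Complex.I * θ₂) * (θ₁ - Complex.I * θ₂) = -((a : ℂ) ^ 2))
    (μ₁ μ₂ m : ℂ) (hm : m ≠ 0) (hm1 : m - 1 ≠ 0) (lama lamh ν : ℂ)
    (hlama : lama = (μ₁ + Complex.I * μ₂) ^ 2 / 2 - 2 * ν ^ 2 - 2)
    (x : archGardingSpace hcpt τ) (hE : (Dh[0,1] - Da[1,0]) x = 0) (hT : D Tc x = (Complex.I * m) • x)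
    (hZ1 : ∀ v : archGardingSpace hcpt τ, D (Matrix.single 0 0 𝐜 + Matrix.single 1 1 𝐜) v = μ₁ • v)
    (hZ2 : ∀ v : archGardingSpace hcpt τ, D (Matrix.single 0 0 𝐜I + Matrix.single 1 1 𝐜I) v = μ₂ • v)
    (hCa : ∑ i : Fin 2, ∑ j : Fin 2, Da[i,j] (Da[j,i] x) = lama • x)
    (hCh : ∀ v : archGardingSpace hcpt τ, ∑ i : Fin 2, ∑ j : Fin 2, Dh[i,j] (Dh[j,i] v) = lamh • v)
    (hx' : ∀ y : ℝ, ℓ (A[y] ((Dh[1,0] + Da[0,1]) x -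
          (1 / (4 * m)) • ((2 : ℂ) • (Dh[0,0] - Dh[1,1]) + (2 : ℂ) • (Da[0,0] - Da[1,1])) ((Dh[1,0] - Da[0,1]) x) -
          (1 / (4 * m * (m - 1))) • (Dh[0,1] + Da[1,0]) ((Dh[1,0] - Da[0,1]) ((Dh[1,0] - Da[0,1]) x)))) = 0)
    (hx : ∃ y : ℝ, ℓ (A[y] x) ≠ 0) :
    lamh = (μ₁ - Complex.I * μ₂) ^ 2 / 2 - 2 * (ν - Complex.I * m) ^ 2 - 2 ∨
      lamh = (μ₁ - Complex.I * μ₂) ^ 2 / 2 - 2 * (ν + Complex.I * m) ^ 2 - 2 := by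
  obtain ⟨c, hc, hdesc⟩ := exists_apply_gardingAct_descent_eq hτ w hτb hℓ hθ₁ hθ₂ ha hθa μ₁ μ₂ m hm hm1 lama lamh ν hlama x
    hE hT hZ1 hZ2 hCa hCh
  obtain ⟨y₀, hy₀⟩ := hx
  have hc0 : c ≠ 0 := by
    intro h0
    apply hy₀
    rw [hc y₀, h0, zero_mul, zero_mul]
  -- `besselMode a ν` does not vanish identically on `(0, ∞)`
  obtain ⟨y₁, hy₁, hb⟩ := exists_besselMode_ne_zero ν ha
  have hθh : θ₁ - Complex.I * θ₂ ≠ 0 := by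
    intro h0
    rw [h0, mul_zero] at hθa
    exact pow_ne_zero 2 (Complex.ofReal_ne_zero.mpr ha.ne') (neg_eq_zero.mp hθa.symm)
  have h := hdesc (Real.log y₁)
  rw [hx' (Real.log y₁), Real.exp_log hy₁] at h
  have hY : ((y₁ : ℝ) : ℂ) ^ ((μ₁ + m + 1) / 2 - 1) ≠ 0 := by
    rw [Ne, Complex.cpow_eq_zero_iff, not_and_or]
    exact Or.inl (Complex.ofReal_ne_zero.mpr hy₁.ne')
  have hprod : (lamh - ((μ₁ - Complex.I * μ₂) ^ 2 / 2 - 2 * (ν - Complex.I * m) ^ 2 - 2)) *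
      (lamh - ((μ₁ - Complex.I * μ₂) ^ 2 / 2 - 2 * (ν + Complex.I * m) ^ 2 - 2)) = 0 := by
    have hden : 8 * (θ₁ - Complex.I * θ₂) * m * (m - 1) ≠ 0 :=
      mul_ne_zero (mul_ne_zero (mul_ne_zero (by norm_num) hθh) hm) hm1
    have hQ : -((lamh - ((μ₁ - Complex.I * μ₂) ^ 2 / 2 - 2 * (ν - Complex.I * m) ^ 2 - 2)) *
        (lamh - ((μ₁ - Complex.I * μ₂) ^ 2 / 2 - 2 * (ν + Complex.I * m) ^ 2 - 2))) /
          (8 * (θ₁ - Complex.I * θ₂) * m * (m - 1)) = 0 := by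
      rcases mul_eq_zero.mp h.symm with h' | h'
      · rcases mul_eq_zero.mp h' with h'' | h''
        · rcases mul_eq_zero.mp h'' with h3 | h3
          · exact absurd h3 hc0
          · exact h3
        · exact absurd h'' hY
      · exact absurd h' hb
    rwa [div_eq_zero_iff, or_iff_left hden, neg_eq_zero] at hQ
  rcases mul_eq_zero.mp hprod with h1 | h1
  · exact Or.inl (sub_eq_zero.mp h1)
  · exact Or.inr (sub_eq_zero.mp h1)

end Descent

end Literature.NumberTheory.Automorphic
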